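import Summits.AtomisticToContinuum.Crystallization.Theorems.HullExactificationCascadeHcpLandscapeGapStubExactWindowEnergy
import Summits.AtomisticToContinuum.Crystallization.Theorems.HullExactificationCascadeHullBulkOptimalCut
import Literature.MathematicalPhysics.StatisticalMechanics.BarlowStackingHeights

/-!
# Crux `HcpLandscapeGap` (stmt-AtomisticToContinuum-12087), line `registered` (birth) — lead helper RE
# `stub_windowEnergyHeights`: the window energy dominates half the sum of the full site energies (multilattices)

Heights analogue of stub E1 (`stub_exactWindowEnergy`, p158213) for the relaxed-Barlow cut of skeleton
v10/v11 (`Cruxes/HcpLandscapeGap/Lines/birth.lean`, lead c6).  For `a ∈ [47/50, 1]`, a Hägg word `s`,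
a height profile `H` with every spacing in `[39a/50, 17a/20]` and an injective finite family `x` of points
of the Barlow multilattice `S = barlowStackingH a H s`:

  `∑_t ∑'_{z ∈ S, z ≠ x t} V_LJ (dist (x t) z) ≤ 2 · 𝓔_LJ(x)`.

Mechanism (as in E1).  Two distinct points of `S` are at squared distance `≥ 4/5`
(`le_dist_barlowPosH_sq`: same layer `≥ a²`; adjacent layers: label difference `±1`, lateral form
`3(2Δi + Δj ± 1)² + (3Δj ± 1)² ≥ 4` (`ExactWindowEnergy.four_le_lateralForm`) gives lateral² `≥ a²/3`, and the
spacing² is `≥ (39a/50)²`; layers two or more apart are `≥ 39a/25` apart), so every pair interaction is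
`≤ 0` (`ExactWindowEnergy.lennardJones_nonpos_of_half_le`).  Hence for each `t` the full site sum over
`S ∖ {x t}` (summable: `S` is `7/10`-separated, `HullBulkOptimal.summable_lennardJones_site`) is at most its
partial sum over the finite subfamily `{x t' : t' ≠ t}`, which is `siteEnergy V_LJ x t`; summing over `t`,
`two_mul_interactionEnergy` concludes.  All `[folklore]`.
-/

noncomputable section

namespace Summit.AtomisticToContinuum.Crystallization.Theorems.HcpLandscapeGapBirth

open Literature.MathematicalPhysics.StatisticalMechanics
open Summit.AtomisticToContinuum.Crystallization.Theorems

namespace RelaxedWindowEnergy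

/-- **Pair distances in a Barlow multilattice on the box.** For `47/50 ≤ a`, heights `H` with spacings
`≥ 39a/50` and a Hägg sequence `s`, two distinct points of `barlowStackingH a H s` are at squared distance
`≥ 4/5` (same layer: `≥ a² ≥ 0.88`; adjacent layers: `≥ a²/3 + (39a/50)² ≥ 0.83`; layers `≥ 2` apart:
`≥ (39a/25)² ≥ 2.1`). [folklore] -/
theorem le_dist_barlowPosH_sq {a : ℝ} {H : ℤ → ℝ} {s : ℤ → ℤ} (ha : 47 / 50 ≤ a)
    (hgap : ∀ k : ℤ, 39 / 50 * a ≤ H (k + 1) - H k)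
    (hs : IsHaggSeq s) {k i j k' i' j' : ℤ} (hne : (k, i, j) ≠ (k', i', j')) :
    4 / 5 ≤ dist (barlowPosH a H s k i j) (barlowPosH a H s k' i' j') ^ 2 := by
  have ha0 : 0 ≤ a := by linarith
  have ha2 : (47 / 50 : ℝ) * (47 / 50) ≤ a * a := mul_self_le_mul_self (by norm_num) ha
  have hg0 : (0 : ℝ) ≤ 39 / 50 * a := by positivity
  rcases eq_or_ne k k' with rfl | hk
  · -- same layer
    have hij : (i, j) ≠ (i', j') := by
      intro h0
      apply hne
      obtain ⟨rfl, rfl⟩ := Prod.mk.inj h0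
      rfl
    have h1 : a ≤ dist (barlowPosH a H s k i j) (barlowPosH a H s k i' j') :=
      le_dist_barlowPosH_of_ne a H s ha0 hij
    have h2 : a * a ≤ dist (barlowPosH a H s k i j) (barlowPosH a H s k i' j') *
        dist (barlowPosH a H s k i j) (barlowPosH a H s k i' j') := mul_self_le_mul_self ha0 h1
    nlinarith
  · rw [dist_barlowPosH_sq]
    by_cases hk1 : k - k' = 1 ∨ k - k' = -1
    · -- adjacent layers
      have hL := ExactWindowEnergy.haggLabel_sub_of_adjacent hs hk1
      have hform : (4 : ℤ) ≤ 3 * (2 * (i - i') + (j - j') + (haggLabel s k - haggLabel s k')) ^ 2 +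
          (3 * (j - j') + (haggLabel s k - haggLabel s k')) ^ 2 :=
        ExactWindowEnergy.four_le_lateralForm _ _ _ hL
      have hformR : (4 : ℝ) ≤ 3 * (2 * ((i : ℝ) - i') + ((j : ℝ) - j') +
          ((haggLabel s k : ℝ) - haggLabel s k')) ^ 2 +
          (3 * ((j : ℝ) - j') + ((haggLabel s k : ℝ) - haggLabel s k')) ^ 2 := by
        exact_mod_cast hform
      have h3 : (√3 : ℝ) ^ 2 = 3 := Real.sq_sqrt (by norm_num)
      have hid := ExactWindowEnergy.lateral_sq_eq a ((i : ℝ) - i') ((j : ℝ) - j')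
        ((haggLabel s k : ℝ) - haggLabel s k') √3 h3
      -- the vertical separation of adjacent layers is at least one spacing
      have hZ : (39 / 50 * a) ^ 2 ≤ (H k - H k') ^ 2 := by
        rcases hk1 with h1 | h1
        · obtain rfl : k = k' + 1 := by omega
          have h4 := hgap k'
          nlinarith
        · obtain rfl : k' = k + 1 := by omega
          have h4 := hgap k
          have h5 : (H k - H (k + 1)) ^ 2 = (H (k + 1) - H k) ^ 2 := by ring
          rw [h5]
          nlinarith
      rw [hid]
      have h4 : a ^ 2 / 12 * 4 ≤ a ^ 2 / 12 * (3 * (2 * ((i : ℝ) - i') + ((j : ℝ) - j') +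
          ((haggLabel s k : ℝ) - haggLabel s k')) ^ 2 +
          (3 * ((j : ℝ) - j') + ((haggLabel s k : ℝ) - haggLabel s k')) ^ 2) :=
        mul_le_mul_of_nonneg_left hformR (by positivity)
      nlinarith
    · -- layers at least two apart
      have hk2 : 2 ≤ k - k' ∨ 2 ≤ k' - k := by omega
      have hZ : (2 * (39 / 50 * a)) ^ 2 ≤ (H k - H k') ^ 2 := by
        rcases hk2 with h2 | h2
        · have h5 := sub_le_of_gap_le H hgap (show k' ≤ k by omega)
          have h6 : (2 : ℝ) ≤ (k : ℝ) - k' := by exact_mod_cast (show (2 : ℤ) ≤ k - k' from h2)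
          have h7 : 2 * (39 / 50 * a) ≤ H k - H k' := by nlinarith
          nlinarith
        · have h5 := sub_le_of_gap_le H hgap (show k ≤ k' by omega)
          have h6 : (2 : ℝ) ≤ (k' : ℝ) - k := by exact_mod_cast (show (2 : ℤ) ≤ k' - k from h2)
          have h7 : 2 * (39 / 50 * a) ≤ H k' - H k := by nlinarith
          have h8 : (H k - H k') ^ 2 = (H k' - H k) ^ 2 := by ring
          rw [h8]
          nlinarith
      nlinarith [sq_nonneg (a * ((i - i') + (j - j') / 2 + (haggLabel s k - haggLabel s k') / 2)),
        sq_nonneg (a * √3 / 2 * ((j - j') + (haggLabel s k - haggLabel s k') / 3))]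

/-- **All pair interactions in a Barlow multilattice on the box are `≤ 0`**: `V_LJ (dist p q) ≤ 0` for
all points `p, q` (distinct points: `r² ≥ 4/5`, `r⁶ ≥ 64/125 ≥ 1/2`; equal points: `V_LJ 0 = 0`).
[folklore] -/
theorem lennardJones_dist_barlowPosH_nonpos {a : ℝ} {H : ℤ → ℝ} {s : ℤ → ℤ} (ha : 47 / 50 ≤ a)
    (hgap : ∀ k : ℤ, 39 / 50 * a ≤ H (k + 1) - H k) (hs : IsHaggSeq s) (k i j k' i' j' : ℤ) :
    lennardJones (dist (barlowPosH a H s k i j) (barlowPosH a H s k' i' j')) ≤ 0 := by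
  by_cases hne : (k, i, j) = (k', i', j')
  · simp only [Prod.mk.injEq] at hne
    obtain ⟨rfl, rfl, rfl⟩ := hne
    rw [dist_self, lennardJones_zero]
  · refine ExactWindowEnergy.lennardJones_nonpos_of_half_le ?_
    have h1 := le_dist_barlowPosH_sq ha hgap hs hne
    have h2 : ((4 : ℝ) / 5) ^ 3 ≤
        (dist (barlowPosH a H s k i j) (barlowPosH a H s k' i' j') ^ 2) ^ 3 :=
      pow_le_pow_left₀ (by norm_num) h1 3
    calc (1 : ℝ) / 2 ≤ (4 / 5) ^ 3 := by norm_num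
      _ ≤ _ := h2
      _ = _ := by ring

/-- The multilattice on the box is `7/10`-separated. [folklore] -/
theorem sep_barlowStackingH {a : ℝ} {H : ℤ → ℝ} {s : ℤ → ℤ} (ha : 47 / 50 ≤ a)
    (hgap : ∀ k : ℤ, 39 / 50 * a ≤ H (k + 1) - H k) :
    ∀ p ∈ barlowStackingH a H s, ∀ q ∈ barlowStackingH a H s, p ≠ q → 7 / 10 ≤ dist p q := by
  intro p hp q hq hpq
  have ha0 : 0 ≤ a := by linarith
  have hg0 : (0 : ℝ) ≤ 39 / 50 * a := by positivity
  have h1 := le_dist_of_mem_barlowStackingH a H s ha0 hg0 hgap hp hq hpq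
  have h2 : (7 / 10 : ℝ) ≤ min a (39 / 50 * a) := le_min (by linarith) (by linarith)
  exact h2.trans h1

/-- **Per-site inequality.** For an injective finite family `x` of multilattice points, the full site
sum `∑'_{z ∈ S, z ≠ x t} V_LJ (dist (x t) z)` is at most the finite site energy `siteEnergy V_LJ x t`
(a summable family with nonpositive terms is dominated by any of its partial sums; the terms
`V_LJ (dist (x t) (x t'))`, `t' ≠ t`, form such a partial sum). [folklore] -/
theorem tsum_site_le_siteEnergy {a : ℝ} {H : ℤ → ℝ} {s : ℤ → ℤ} (ha : 47 / 50 ≤ a)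
    (hgap : ∀ k : ℤ, 39 / 50 * a ≤ H (k + 1) - H k) (hs : IsHaggSeq s)
    {n : ℕ} {x : Fin n → EuclideanSpace ℝ (Fin 3)} (hx : Function.Injective x)
    (hmem : ∀ t : Fin n, x t ∈ barlowStackingH a H s) (t : Fin n) :
    (∑' z : ↥{z : EuclideanSpace ℝ (Fin 3) | z ∈ barlowStackingH a H s ∧ z ≠ x t},
        lennardJones (dist (x t) (z : EuclideanSpace ℝ (Fin 3)))) ≤ siteEnergy lennardJones x t := by
  classical
  set T : Set (EuclideanSpace ℝ (Fin 3)) :=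
    {z : EuclideanSpace ℝ (Fin 3) | z ∈ barlowStackingH a H s ∧ z ≠ x t} with hT
  -- summability of the full site family
  have hsum : Summable fun z : ↥T => lennardJones (dist (x t) (z : EuclideanSpace ℝ (Fin 3))) :=
    HullBulkOptimal.summable_lennardJones_site (by norm_num : (0 : ℝ) < 7 / 10)
      (sep_barlowStackingH ha hgap) (hmem t)
  -- every term is nonpositive
  have hnp : ∀ z : ↥T, lennardJones (dist (x t) (z : EuclideanSpace ℝ (Fin 3))) ≤ 0 := by
    intro z
    obtain ⟨k, i, j, hk⟩ := (mem_barlowStackingH_iff).1 (hmem t)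
    obtain ⟨k', i', j', hk'⟩ := (mem_barlowStackingH_iff).1 z.2.1
    rw [hk, hk']
    exact lennardJones_dist_barlowPosH_nonpos ha hgap hs _ _ _ _ _ _
  -- the finite subfamily `t' ≠ t`, as a finset of points of `T`
  set ι : {t' // t' ∈ Finset.univ.erase t} → ↥T := fun t' =>
    ⟨x t'.1, hmem t'.1, fun h => (Finset.mem_erase.1 t'.2).1 (hx h)⟩ with hι
  have hιinj : Function.Injective ι := by
    intro t₁ t₂ h12
    have h' : x t₁.1 = x t₂.1 := congrArg (fun z : ↥T => (z : EuclideanSpace ℝ (Fin 3))) h12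
    exact Subtype.ext (hx h')
  have hpartial := hsum.neg.sum_le_tsum (((Finset.univ.erase t).attach).image ι)
    fun z _ => neg_nonneg.2 (hnp z)
  rw [tsum_neg, Finset.sum_neg_distrib, neg_le_neg_iff,
    Finset.sum_image fun t₁ _ t₂ _ h12 => hιinj h12] at hpartial
  -- identify the partial sum with the finite site energy
  have hsite : siteEnergy lennardJones x t =
      ∑ t' ∈ (Finset.univ.erase t).attach,
        lennardJones (dist (x t) ((ι t' : ↥T) : EuclideanSpace ℝ (Fin 3))) := by
    rw [siteEnergy]
    exact (Finset.sum_attach (Finset.univ.erase t) (fun t' => lennardJones (dist (x t) (x t')))).symm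
  rw [hsite]
  exact hpartial

end RelaxedWindowEnergy

open RelaxedWindowEnergy in
/-- **Lead helper RE — the window energy dominates half the sum of the full site energies
(multilattices).**  For `a ∈ [47/50, 1]`, a Hägg word `s`, heights `H` with spacings in
`[39a/50, 17a/20]` and an injective finite family `x` of points of `barlowStackingH a H s`:
`∑_t ∑'_{z ∈ S, z ≠ x t} V_LJ (dist (x t) z) ≤ 2 · 𝓔_LJ(x)` (sum over `t` of
`RelaxedWindowEnergy.tsum_site_le_siteEnergy`, and `two_mul_interactionEnergy`). [folklore] -/
theorem stub_windowEnergyHeights : ∀ (a : ℝ), 47 / 50 ≤ a → a ≤ 1 → ∀ s : ℤ → ℤ, Literature.MathematicalPhysics.StatisticalMechanics.IsHaggSeq s → ∀ H : ℤ → ℝ, (∀ k : ℤ, 39 / 50 * a ≤ H (k + 1) - H k ∧ H (k + 1) - H k ≤ 17 / 20 * a) → ∀ (n : ℕ) (x : Fin n → EuclideanSpace ℝ (Fin 3)), Function.Injective x → (∀ t : Fin n, x t ∈ Literature.MathematicalPhysics.StatisticalMechanics.barlowStackingH a H s) → ∑ t : Fin n, (∑' z : ↥{z : EuclideanSpace ℝ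 (Fin 3) | z ∈ Literature.MathematicalPhysics.StatisticalMechanics.barlowStackingH a H s ∧ z ≠ x t}, Literature.MathematicalPhysics.StatisticalMechanics.lennardJones (dist (x t) (z : EuclideanSpace ℝ (Fin 3)))) ≤ 2 * Literature.MathematicalPhysics.StatisticalMechanics.interactionEnergy Literature.MathematicalPhysics.StatisticalMechanics.lennardJones x := by
  intro a ha _ha1 s hs H hH n x hx hmem
  rw [two_mul_interactionEnergy]
  exact Finset.sum_le_sum fun t _ => tsum_site_le_siteEnergy ha (fun k => (hH k).1) hs hx hmem t

end Summit.AtomisticToContinuum.Crystallization.Theorems.HcpLandscapeGapBirth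

end
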